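import Mathlib
import HarnessLib
import Summits.HubbardSuperconductivity.HubbardSuperconductivity.Theorems.KLProgrammeC4aPPKernelShiftNumeratorFar
import Summits.HubbardSuperconductivity.HubbardSuperconductivity.Theorems.KLProgrammeC4aPPKernelTrueFlatness

/-!
# Route `KLProgramme` — crux C4a, S3 brick (B4) «(B4)-UMK1», «(M1)-TRUE-KERNEL» adaptation (Ω), part 3: the shifted numerator ALONG AN ANTI-DIAGONAL —
# continuity, the line derivative `d/de N_Ω(e,D−e) = ∂ₑN_Ω − ∂ᵤN_Ω` (termwise), the two-sided far formula, and the `u`-derivative of the transfer kernel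

Cell `gate-hubbard-kl`, seat hubbard-kl-k3c3-p1 (g15; row «δμ-flow with klAngularMean constant piece»).  Continuation of `…C4aPPKernelShiftNumeratorFar`
(stub (C) of stmt-HubbardSuperconductivity-20437; note `M1-TRUE-KERNEL.md` §6–§7): the Ω-twins of `…C4aPPKernelTrueFlatness` §1–§2, §4 (first half) —
the regularity inputs `hn`, `hn₁c`, `hn₂c`, `hnc` of the abstract transfer lemma `…C4aAntidiagonalFlatnessTransfer.norm_integral_antidiagonal_flatness_transfer_le`
for `n(e) = N_Ω(e,D−e)`, `n₁(e) = ∂ₑN_Ω(e,D−e)`, `n₂(e) = ∂ᵤN_Ω(e,D−e)`: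
* §1 `continuous_resolventFnXi_level`, `continuous_resolventFnXiD1_level`, `continuous_ppShiftSummand_comp`, `continuous_ppShiftSummandDu_comp`,
  `continuous_shiftNumerator_line`, `continuous_shiftNumeratorDu_line`, `continuous_shiftNumeratorDe_line` (`continuous_tsum` with the uniform dominators);
* §2 **`hasDerivAt_ppShiftNumerator_line`**: `d/de N_Ω(e, D−e) = ∂ᵤN_Ω(D−e, e)·[re-indexed] − ∂ᵤN_Ω(e, D−e)` i.e. `= ppShiftNumeratorDu m (D−e) e − ppShiftNumeratorDu m e (D−e)`
  (termwise differentiation; the first family is re-indexed by `n ↦ m−1−n`);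
* §3 `ppShiftNumeratorDu_of_far_of_far`: both levels above the shell ⟹ `∂ᵤN_Ω(e,u) = (β/4)sech²(βu/2)` exactly (Ω-independent);
* §4 `hasDerivAt_shiftKernel_u`: the `u`-derivative at `u = D−e` of the transfer kernel `𝒦_Ω(e,u) = N_Ω(e,u)·κ(e/(e+u))·(e+u−iΩ)⁻¹` is the integrand `KuΩ` of the
  transfer lemma.
Pure real/complex analysis; nothing asserts (C), K3 or superconductivity.
References: BGM 2006 §2.1 (2.3), §2.4 [cite: BenfattoGiulianiMastropietro2006]; Salmhofer 1999 §4.2.5 [cite: Salmhofer1999].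
-/

noncomputable section

namespace Summit.HubbardSuperconductivity.HubbardSuperconductivity.Theorems.C4a

set_option linter.dupNamespace false -- summit = problem name (single-conjunct summit), D-0017

open Real Filter Set Complex
open scoped Topology
open Literature.MathematicalPhysics.QuantumLattice Literature.Analysis.SpecialFunctions

/-! ## §1 Continuity along the anti-diagonal -/

/-- The resolvent denominator `−iω + x` never vanishes for `ω ≠ 0`. [folklore] -/
theorem uvDen_ne_zero_of_ne {ω : ℝ} (hω : ω ≠ 0) (x : ℝ) : (-I * ((ω + 0 : ℝ) : ℂ) + (x : ℂ)) ≠ 0 := by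
  intro h
  have h1 := abs_le_norm_uvDen x ω
  rw [h, norm_zero] at h1
  exact hω (abs_eq_zero.1 (le_antisymm h1 (abs_nonneg _)))

/-- `x ↦ r(ω,x) = 1/(−iω+x)` is continuous for `ω ≠ 0`. [cite: BenfattoGiulianiMastropietro2006, §2.1 (2.3)] -/
theorem continuous_resolventFnXi_level {ω : ℝ} (hω : ω ≠ 0) : Continuous fun x : ℝ => resolventFnXi 1 0 ω x :=
  continuous_iff_continuousAt.2 fun x => (hasDerivAt_resolventFnXi (c := 1) (uvDen_ne_zero_of_ne hω x)).continuousAt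

/-- `x ↦ r′(ω,x) = −1/(−iω+x)²` is continuous for `ω ≠ 0`. [cite: BenfattoGiulianiMastropietro2006, §2.1 (2.3)] -/
theorem continuous_resolventFnXiD1_level {ω : ℝ} (hω : ω ≠ 0) : Continuous fun x : ℝ => resolventFnXiD1 1 0 ω x := by
  unfold resolventFnXiD1
  exact continuous_const.div ((continuous_const.add continuous_ofReal).pow 2) fun x => pow_ne_zero 2 (uvDen_ne_zero_of_ne hω x)

/-- Each summand of `N_Ω` is continuous along any pair of continuous level curves. [cite: BenfattoGiulianiMastropietro2006, §2.1 (2.3)] -/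
theorem continuous_ppShiftSummand_comp {β : ℝ} (hβ : 0 < β) (Λ : ℝ) (m n : ℤ) {a b : ℝ → ℝ} (ha : Continuous a) (hb : Continuous b) :
    Continuous fun x => ppShiftSummand β Λ m (a x) (b x) n := by
  have h1 := ppFreqZ_ne_zero hβ n
  have h2 : ppBose β m - ppFreqZ β n ≠ 0 := by rw [ppBose_sub_ppFreqZ]; exact ppFreqZ_ne_zero hβ _
  unfold ppShiftSummand
  exact ((continuous_ofReal.comp ((continuous_uvWeightFn_level Λ _).comp ha)).mul
    (continuous_ofReal.comp ((continuous_uvWeightFn_level Λ _).comp hb))).mul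
    (((continuous_resolventFnXi_level h1).comp ha).add ((continuous_resolventFnXi_level h2).comp hb))

/-- Each summand of `∂ᵤN_Ω` is continuous along any pair of continuous level curves. [cite: BenfattoGiulianiMastropietro2006, §2.4 (2.36)] -/
theorem continuous_ppShiftSummandDu_comp {β : ℝ} (hβ : 0 < β) (Λ : ℝ) (m n : ℤ) {a b : ℝ → ℝ} (ha : Continuous a) (hb : Continuous b) :
    Continuous fun x => ppShiftSummandDu β Λ m (a x) (b x) n := by
  have h1 := ppFreqZ_ne_zero hβ n
  have h2 : ppBose β m - ppFreqZ β n ≠ 0 := by rw [ppBose_sub_ppFreqZ]; exact ppFreqZ_ne_zero hβ _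
  unfold ppShiftSummandDu
  refine (continuous_ofReal.comp ((continuous_uvWeightFn_level Λ _).comp ha)).mul
    (((continuous_ofReal.comp ((continuous_uvWeightFnD1_level Λ _).comp hb)).mul
      (((continuous_resolventFnXi_level h1).comp ha).add ((continuous_resolventFnXi_level h2).comp hb))).add
      ((continuous_ofReal.comp ((continuous_uvWeightFn_level Λ _).comp hb)).mul ((continuous_resolventFnXiD1_level h2).comp hb)))

/-- **`e ↦ N_Ω(e, D−e)` is continuous** (`m ≠ 0`; dominated convergence with the uniform product majorant on the line `e+u = D`).
[cite: BenfattoGiulianiMastropietro2006, §2.1 (2.3)] -/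
theorem continuous_shiftNumerator_line {β Λ : ℝ} (hβ : 0 < β) (hΛ : 0 < Λ) {m : ℤ} (hm : m ≠ 0) (D : ℝ) :
    Continuous fun e : ℝ => ppShiftNumerator β Λ m e (D - e) := by
  unfold ppShiftNumerator
  refine continuous_const.mul ?_
  have hw : ∀ e : ℝ, (e : ℂ) + ((D - e : ℝ) : ℂ) - I * (ppBose β m : ℝ) = (D : ℂ) - I * (ppBose β m : ℝ) := fun e => by push_cast; ring
  have hs : (D : ℂ) - I * (ppBose β m : ℝ) ≠ 0 := by have h := transferDen_ne_zero hβ hm 0 D; simpa using h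
  refine continuous_tsum (fun n => continuous_ppShiftSummand_comp hβ Λ m n continuous_id (continuous_const.sub continuous_id))
    ((((summable_one_div_ppFreqZ_sq_add_sq hβ Λ).add (summable_one_div_shift_sq_add_sq hβ m Λ))).mul_left (4 * ‖(D : ℂ) - I * (ppBose β m : ℝ)‖))
    fun n e => ?_
  have h := norm_ppShiftSummand_le hΛ m e (D - e) (by rw [hw e]; exact hs) n
  rw [hw e] at h
  exact h

/-- **`e ↦ ∂ᵤN_Ω(e, D−e)` is continuous.** [cite: BenfattoGiulianiMastropietro2006, §2.4 (2.36)] -/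
theorem continuous_shiftNumeratorDu_line {β Λ : ℝ} (hβ : 0 < β) (hΛ : 0 < Λ) {B₁ : ℝ} (hB₁ : ∀ x, |deriv salmhoferCutoff x| ≤ B₁) (m : ℤ) (D : ℝ) :
    Continuous fun e : ℝ => ppShiftNumeratorDu β Λ m e (D - e) := by
  unfold ppShiftNumeratorDu
  refine continuous_const.mul ?_
  refine continuous_tsum (fun n => continuous_ppShiftSummandDu_comp hβ Λ m n continuous_id (continuous_const.sub continuous_id))
    ((summable_one_div_shift_sq_add_sq hβ m Λ).mul_left (12 * B₁ + 5)) fun n e => ?_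
  rw [← div_eq_mul_one_div]
  exact norm_ppShiftSummandDu_le_unif hβ hΛ hB₁ m e (D - e) n

/-- **`e ↦ ∂ₑN_Ω(e, D−e) = ppShiftNumeratorDu m (D−e) e` is continuous.** [cite: BenfattoGiulianiMastropietro2006, §2.4 (2.36)] -/
theorem continuous_shiftNumeratorDe_line {β Λ : ℝ} (hβ : 0 < β) (hΛ : 0 < Λ) {B₁ : ℝ} (hB₁ : ∀ x, |deriv salmhoferCutoff x| ≤ B₁) (m : ℤ) (D : ℝ) :
    Continuous fun e : ℝ => ppShiftNumeratorDu β Λ m (D - e) e := by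
  unfold ppShiftNumeratorDu
  refine continuous_const.mul ?_
  refine continuous_tsum (fun n => continuous_ppShiftSummandDu_comp hβ Λ m n (continuous_const.sub continuous_id) continuous_id)
    ((summable_one_div_shift_sq_add_sq hβ m Λ).mul_left (12 * B₁ + 5)) fun n e => ?_
  rw [← div_eq_mul_one_div]
  exact norm_ppShiftSummandDu_le_unif hβ hΛ hB₁ m (D - e) e n

/-! ## §2 The derivative of `N_Ω` along the anti-diagonal -/

/-- Re-indexing identities `ω_{m−1−n} = Ω − ωₙ`, `Ω − ω_{m−1−n} = ωₙ`. [folklore] -/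
theorem ppFreqZ_reflect (β : ℝ) (m n : ℤ) : ppFreqZ β (m - 1 - n) = ppBose β m - ppFreqZ β n ∧ ppBose β m - ppFreqZ β (m - 1 - n) = ppFreqZ β n := by
  refine ⟨(ppBose_sub_ppFreqZ β m n).symm, ?_⟩
  rw [ppBose_sub_ppFreqZ]; congr 1; ring

/-- **THE LINE DERIVATIVE.** `m ≠ 0`: `d/de N_Ω(e, D−e) = ppShiftNumeratorDu m (D−e) e − ppShiftNumeratorDu m e (D−e)` at every `e` (termwise differentiation of
the absolutely dominated series; the loop-level family re-indexed by `n ↦ m−1−n`). [cite: BenfattoGiulianiMastropietro2006, §2.4 (2.36)] -/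
theorem hasDerivAt_ppShiftNumerator_line {β Λ : ℝ} (hβ : 0 < β) (hΛ : 0 < Λ) {B₁ : ℝ} (hB₁ : ∀ x, |deriv salmhoferCutoff x| ≤ B₁) {m : ℤ} (hm : m ≠ 0)
    (D e : ℝ) :
    HasDerivAt (fun x : ℝ => ppShiftNumerator β Λ m x (D - x)) (ppShiftNumeratorDu β Λ m (D - e) e - ppShiftNumeratorDu β Λ m e (D - e)) e := by
  -- the two term families
  set t₁ : ℤ → ℝ → ℂ := fun n x => ppShiftSummandDu β Λ m (D - x) x (m - 1 - n) with ht₁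
  set t₂ : ℤ → ℝ → ℂ := fun n x => ppShiftSummandDu β Λ m x (D - x) n with ht₂
  set dom : ℤ → ℝ := fun n => (12 * B₁ + 5) * (1 / (ppFreqZ β n ^ 2 + Λ ^ 2)) + (12 * B₁ + 5) * (1 / ((ppBose β m - ppFreqZ β n) ^ 2 + Λ ^ 2))
    with hdom
  have hsdom : Summable dom := ((summable_one_div_ppFreqZ_sq_add_sq hβ Λ).mul_left _).add ((summable_one_div_shift_sq_add_sq hβ m Λ).mul_left _)
  have hb₁ : ∀ n x, ‖t₁ n x‖ ≤ (12 * B₁ + 5) * (1 / (ppFreqZ β n ^ 2 + Λ ^ 2)) := fun n x => by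
    have h := norm_ppShiftSummandDu_le_unif hβ hΛ hB₁ m (D - x) x (m - 1 - n)
    rw [(ppFreqZ_reflect β m n).2] at h
    rw [← div_eq_mul_one_div]; exact h
  have hb₂ : ∀ n x, ‖t₂ n x‖ ≤ (12 * B₁ + 5) * (1 / ((ppBose β m - ppFreqZ β n) ^ 2 + Λ ^ 2)) := fun n x => by
    rw [← div_eq_mul_one_div]; exact norm_ppShiftSummandDu_le_unif hβ hΛ hB₁ m x (D - x) n
  -- termwise differentiation
  have hser : HasDerivAt (fun x : ℝ => ∑' n : ℤ, ppShiftSummand β Λ m x (D - x) n) (∑' n : ℤ, (t₁ n e - t₂ n e)) e := by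
    refine hasDerivAt_tsum (u := dom) (g := fun (n : ℤ) (x : ℝ) => ppShiftSummand β Λ m x (D - x) n) (g' := fun n x => t₁ n x - t₂ n x) hsdom
      (fun n x => ?_) (fun n x => ?_) (y₀ := e) (summable_ppShiftSummand hβ hΛ hm e (D - e)) e
    · -- one term: `W(ωₙ,x)·W(ω′,D−x)·(r(ωₙ,x) + r(ω′,D−x))`
      set ω' : ℝ := ppBose β m - ppFreqZ β n with hω'
      have hωn := ppFreqZ_ne_zero hβ n
      have hω'ne : ω' ≠ 0 := by rw [hω', ppBose_sub_ppFreqZ]; exact ppFreqZ_ne_zero hβ _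
      have hA : HasDerivAt (fun y => ((uvWeightFn Λ (ppFreqZ β n) y : ℝ) : ℂ)) ((uvWeightFnD1 Λ (ppFreqZ β n) x : ℝ) : ℂ) x :=
        (hasDerivAt_uvWeightFn Λ (ppFreqZ β n) x).ofReal_comp
      have hB : HasDerivAt (fun y => ((uvWeightFn Λ ω' (D - y) : ℝ) : ℂ)) ((-uvWeightFnD1 Λ ω' (D - x) : ℝ) : ℂ) x := by
        have h := ((hasDerivAt_uvWeightFn Λ ω' (D - x)).comp x ((hasDerivAt_id x).const_sub D)).ofReal_comp
        refine (h.congr_of_eventuallyEq (Eventually.of_forall fun y => rfl)).congr_deriv ?_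
        push_cast; ring
      have hC1 : HasDerivAt (fun y : ℝ => resolventFnXi 1 0 (ppFreqZ β n) y) (resolventFnXiD1 1 0 (ppFreqZ β n) x) x :=
        hasDerivAt_resolventFnXi (uvDen_ne_zero_of_ne hωn x)
      have hC2 : HasDerivAt (fun y : ℝ => resolventFnXi 1 0 ω' (D - y)) (-resolventFnXiD1 1 0 ω' (D - x)) x := by
        have h := (hasDerivAt_resolventFnXi (c := 1) (uvDen_ne_zero_of_ne hω'ne (D - x))).scomp x ((hasDerivAt_id x).const_sub D)
        refine (h.congr_of_eventuallyEq (Eventually.of_forall fun y => rfl)).congr_deriv ?_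
        simp
      have h := (hA.fun_mul hB).fun_mul (hC1.fun_add hC2)
      refine (h.congr_of_eventuallyEq (Eventually.of_forall fun y => by simp only [ppShiftSummand, ← hω'])).congr_deriv ?_
      have hrefl2 : ppBose β m - ω' = ppFreqZ β n := by rw [hω']; ring
      simp only [ht₁, ht₂, ppShiftSummandDu, (ppFreqZ_reflect β m n).1, ← hω', hrefl2]
      push_cast
      ring
    · exact (norm_sub_le _ _).trans (add_le_add (hb₁ n x) (hb₂ n x))
  -- split the derivative series, re-index the first family, restore the factor `1/β`
  have hs₁ : Summable fun n => t₁ n e := Summable.of_norm_bounded ((summable_one_div_ppFreqZ_sq_add_sq hβ Λ).mul_left _) fun n => hb₁ n e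
  have hs₂ : Summable fun n => t₂ n e := Summable.of_norm_bounded ((summable_one_div_shift_sq_add_sq hβ m Λ).mul_left _) fun n => hb₂ n e
  rw [hs₁.tsum_sub hs₂] at hser
  have hre : ∑' n : ℤ, t₁ n e = ∑' k : ℤ, ppShiftSummandDu β Λ m (D - e) e k := by
    simp only [ht₁]
    have h : ∀ n : ℤ, ppShiftSummandDu β Λ m (D - e) e (m - 1 - n) = (fun k : ℤ => ppShiftSummandDu β Λ m (D - e) e k) ((Equiv.subLeft (m - 1)) n) :=
      fun n => by simp only [Equiv.subLeft_apply]
    simp_rw [h]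
    exact Equiv.tsum_eq (Equiv.subLeft (m - 1)) _
  rw [hre] at hser
  unfold ppShiftNumerator ppShiftNumeratorDu
  have h := hser.const_mul (((1 / β : ℝ) : ℂ))
  refine h.congr_deriv ?_
  simp only [ht₂]
  ring

/-! ## §3 Both levels above the shell -/

/-- **`Λ < u`, `Λ < e` ⟹ `∂ᵤN_Ω(e,u) = (β/4)·sech²(βu/2)`** exactly, for every transfer frequency. [cite: BenfattoGiulianiMastropietro2006, §2.4 (2.36)] -/
theorem ppShiftNumeratorDu_of_far_of_far {β Λ e u : ℝ} (hβ : 0 < β) (hΛ : 0 < Λ) (hu : Λ < u) (he : Λ < e) (m : ℤ) :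
    ppShiftNumeratorDu β Λ m e u = ((β / 4 * sech (β * u / 2) ^ 2 : ℝ) : ℂ) := by
  have hu0 : 0 < u := hΛ.trans hu
  rw [ppShiftNumeratorDu_of_far hΛ hu m e]
  have hW : ∀ n : ℤ, uvWeightFn Λ (ppFreqZ β n) e = 1 := fun n =>
    (uvWeightFn_eq_one_of_gt hΛ (by nlinarith [sq_nonneg (ppFreqZ β n), mul_pos hΛ (hΛ.trans he)] : Λ ^ 2 < e ^ 2 + ppFreqZ β n ^ 2)).1
  simp_rw [hW, Complex.ofReal_one, one_mul]
  rw [tsum_shift_eq (fun x => resolventFnXiD1 1 0 x u) β m]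
  exact tsum_int_resolventD1_eq hβ hu0.ne'

/-! ## §4 The `u`-derivative of the transfer kernel -/

/-- **The transfer kernel's `u`-derivative on the anti-diagonal.**  `𝒦_Ω(e,u) = N_Ω(e,u)·κ(e/(e+u))·(e+u−iΩ)⁻¹` (`κ ∈ C¹`, `m ≠ 0`, `0 < D`): at
`u = D − e`, `∂ᵤ𝒦_Ω = (D−iΩ)⁻¹·∂ᵤN_Ω·κ(e/D) − N_Ω·((D−iΩ)⁻¹·κ′(e/D)(e/D)/D + (D−iΩ)⁻²·κ(e/D))` — the integrand `KuΩ` of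
`…C4aAntidiagonalFlatnessTransfer.norm_integral_antidiagonal_flatness_transfer_le`. [cite: BenfattoGiulianiMastropietro2006, §2.4 (2.36)] -/
theorem hasDerivAt_shiftKernel_u {β Λ : ℝ} (hβ : 0 < β) (hΛ : 0 < Λ) {B₁ : ℝ} (hB₁ : ∀ x, |deriv salmhoferCutoff x| ≤ B₁) {m : ℤ} (hm : m ≠ 0)
    {κ κ' : ℝ → ℝ} (hκ : ∀ t, HasDerivAt κ (κ' t) t) {D : ℝ} (hD : 0 < D) (e : ℝ) :
    HasDerivAt (fun v : ℝ => ppShiftNumerator β Λ m e v * (κ (e / (e + v)) : ℂ) * (((e + v : ℝ) : ℂ) - I * (ppBose β m : ℝ))⁻¹)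
      (((D : ℂ) - I * (ppBose β m : ℝ))⁻¹ * (ppShiftNumeratorDu β Λ m e (D - e) * κ (e / D)) -
        ppShiftNumerator β Λ m e (D - e) *
          (((D : ℂ) - I * (ppBose β m : ℝ))⁻¹ * (κ' (e / D) * (e / D)) / D + ((D : ℂ) - I * (ppBose β m : ℝ))⁻¹ ^ 2 * κ (e / D))) (D - e) := by
  set v₀ : ℝ := D - e with hv₀
  have hev : e + v₀ = D := by rw [hv₀]; ring
  set w : ℂ := (D : ℂ) - I * (ppBose β m : ℝ) with hw
  have hwne : w ≠ 0 := by have h := transferDen_ne_zero hβ hm 0 D; simpa [hw] using h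
  -- factor 1: the numerator
  have hN : HasDerivAt (fun v => ppShiftNumerator β Λ m e v) (ppShiftNumeratorDu β Λ m e v₀) v₀ := hasDerivAt_ppShiftNumerator_u hβ hΛ hB₁ hm e v₀
  -- factor 2: the split weight `κ(e/(e+v))`
  have hq : HasDerivAt (fun v : ℝ => e / (e + v)) (-(e / D ^ 2)) v₀ := by
    have h1 : HasDerivAt (fun v : ℝ => e + v) 1 v₀ := (hasDerivAt_id v₀).const_add e
    have h2 := h1.inv (by rw [hev]; exact hD.ne')
    have h3 := h2.const_mul e
    refine (h3.congr_of_eventuallyEq (Eventually.of_forall fun v => by simp [div_eq_mul_inv])).congr_deriv ?_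
    rw [hev]; ring
  have hK : HasDerivAt (fun v : ℝ => (κ (e / (e + v)) : ℂ)) ((κ' (e / D) * -(e / D ^ 2) : ℝ) : ℂ) v₀ := by
    have h := (hκ (e / (e + v₀))).comp v₀ hq
    rw [hev] at h
    exact h.ofReal_comp
  -- factor 3: the transfer resolvent
  have hR : HasDerivAt (fun v : ℝ => (((e + v : ℝ) : ℂ) - I * (ppBose β m : ℝ))⁻¹) (-(1 : ℂ) / w ^ 2) v₀ := by
    have hg : HasDerivAt (fun z : ℂ => ((e : ℂ) + z - I * (ppBose β m : ℝ))⁻¹) (-(1 : ℂ) / w ^ 2) (v₀ : ℂ) := by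
      have h1 : HasDerivAt (fun z : ℂ => (e : ℂ) + z - I * (ppBose β m : ℝ)) 1 (v₀ : ℂ) := ((hasDerivAt_id _).const_add _).sub_const _
      have hval : (e : ℂ) + (v₀ : ℂ) - I * (ppBose β m : ℝ) = w := by rw [hw, ← hev]; push_cast; ring
      have h2 := h1.inv (by rw [hval]; exact hwne)
      rw [hval] at h2
      exact h2
    have h := hg.comp_ofReal
    refine h.congr_of_eventuallyEq (Eventually.of_forall fun v => ?_)
    push_cast; ring_nf
  have h := (hN.fun_mul hK).fun_mul hR
  refine (h.congr_of_eventuallyEq (Eventually.of_forall fun v => rfl)).congr_deriv ?_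
  have hval : (((e + v₀ : ℝ) : ℂ) - I * (ppBose β m : ℝ)) = w := by rw [hev]
  rw [hval, hev]
  have hD0 : (D : ℂ) ≠ 0 := by exact_mod_cast hD.ne'
  push_cast
  field_simp
  ring

end Summit.HubbardSuperconductivity.HubbardSuperconductivity.Theorems.C4a

end
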